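import Summits.QuantumFields.BalabanUV.T4Continuum.Support.NE7PairCurlSupRate
import Summits.QuantumFields.BalabanUV.T4Continuum.Support.NE7CovGradBootstrapAlgebra
import Summits.QuantumFields.BalabanUV.T4Continuum.Support.NE7CurvedGradLetterUniform
import Summits.QuantumFields.BalabanUV.T4Continuum.Support.AveragingDeficitFermat
import Summits.QuantumFields.BalabanUV.T4Continuum.Support.NE3FramePotBoundW
import HarnessLib

/-!
# NE7PairCovGradRate — supplier stub (S-g′) of the NE7 crux, part 4 (ROAD-G108 §1–§2): THE COVARIANT-GRADIENT RATE (Gᶜ_w) OF A DECOMPOSED PAIR COORDINATE AT ONE LEVEL —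
# `‖Ad_{W(x+e_κ,μ)}X(x+e_μ,κ) − X(x,κ)‖ ≤ Λ_G·θ^{38k}` at EVERY bond, from (E), the slice decomposition `X = X_T + X_N` with the sup letters of `X_N`, and the regularity radii of the pair

Cell `pub-balaban`, rung (B)+1 sub-cell t4, lineage `b2b-balaban-t4-ne7-p1`, generation 108 (CRUX PROVER NE7 #1 = OWNER of BINDER row NE7).  Memo `t4/b2b-balaban-t4-ne7-p1-g108/ROAD-G108.md` §1–§2.
THE ARGUMENT (`d = 4`, `L = 2`, level `k = j+1`, `M = 2^k`, `ξ = M⁻¹ = θ^{18k}`).  Let `G` be the MAXIMUM of the covariant gradient of `X` over the (finite) period torus (§1).  At the maximising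
bond, `G ≤ ‖∇_W X_T‖ + ‖∇_W X_N‖`; the normal part TRIVIALLY: `‖∇_W X_N‖ ≤ 2 sup‖X_N‖ ≤ 2c_N‖X‖_w²∕M = O(θ^{54k})` (gen 108's `NE7PairDecompNL0Sup`); the slice part by gen 107's curved C¹
letter with logarithm (`NE7CurvedGradLetterUniform.curved_grad_letter`): `≤ K_G(1 + log M)·B`, `B = sup‖curl_W X‖ + sup‖curl_W X_N‖`, where `sup‖curl_W X‖ ≤ 8l₂²γθ^{42k}` for every
`l₂ ≥ γ` with `Λ₂⁰ + 128C_Sε M²·G ≤ l₂³` (`NE7PairCurlSupRate.curl_sup_rate`, the bootstrap quantity `G` entering (S-b)'s Lipschitz letter).  With `l₀ = max(γ, 1, Λ₂⁰)` and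
`c = 128C_SεM²`: if `cG ≤ l₀³` take `l₂ = 2l₀`; otherwise `l₂³ = 2cG` and `NE7CovGradBootstrapAlgebra.caseB_bound` gives `G ≤ 16c²K′³ + 2R′`, `K′ = 8K_Gγ(1 + log M)θ^{42k}` — and
`16c²K′³ = 2²⁷C_Sε²K_G³γ³(1 + log M)³θ^{54k}`.  The logarithm `1 + log M ≤ 1 + k` costs one power of `θ` per factor (`rate_caseA∕B∕normal`).  RESULT: **`G ≤ Λ_G θ^{38k}`** with the
k-FREE `Λ_G = 32K_G l₀²γD + 2²⁷C_Sε²K_G³γ³D³ + 2(K_G c_Nγ⁶D + 2c_Nγ⁶)`, `D = (1−θ)⁻¹`.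
WHAT ([folklore]; 0 def, 0 sorry).  §1 `exists_max_periodic₃`, `exists_max_covGrad` (the maximum over the period torus of a periodic bond quantity); §2 **`covGrad_rate`** (the theorem above, `K_G, ε₀` of the
curved letter obtained once, hence k- and N-free).
HONEST FRAMING (page 1): composition of landed kernel theorems; (E) and the radii are HYPOTHESES here (the radii of the TYPE of [Balaban1985Variational] Thm 1 (10), asserted for no
minimiser); NOT yet the socket for the minimiser pair (next file), NOT NE3∕NE7; spine count unchanged; finite T⁴ rung (B)+1 — NOT infinite volume, NOT mass gap, NOT BetaPertH, NOT Clay.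
-/

set_option autoImplicit false

open scoped BigOperators Matrix Matrix.Norms.L2Operator
open Finset NormedSpace Set

namespace Summit.QuantumFields.BalabanUV.T4Continuum.NE7PairCovGradRate

open Literature.MathematicalPhysics.QuantumFieldTheory.Balaban1983to89
open B7Prop1Explicit B7Prop2Explicit
open T4AveragingDeficitWall hiding Site Plane Plaq Bond
open T4AveragingDeficitWallBoundary (periodBox IsPeriodicCfg mem_periodBox)
open T4AveragingDeficitNonAbelian (Ad_sub)
open AveragingDeficitNearIdentity (Ad_add)
open AveragingDeficitTransport (norm_Ad_of_unitary)
open AveragingDeficitPeriodicCounting (IsPeriodicDir)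
open AveragingDeficitMultiLevelPrep (LevelSmall tower)
open AveragingDeficitTorusChart (redN eq_wrap_add periodic_smul_vec)
open AveragingDeficitFermat (boxVec_redN_mem)
open NE3EnergyWeightedShapes (energyNormW energyNormW_nonneg)
open NE3EnergyHessBilin (curlAt_add)
open NE3FramePotBoundW (tower_eq_pow_mul)
open BlockAverageCurrent (curConst curConst_nonneg)
open NE7MeanZeroGaugeSliceW (energyBlockLandauW)
open NE7EtaClosenessHolder (theta18_lt_one)
open NE7CurvedGradLetterUniform (curved_grad_letter)
open NE7PairCurlSupRate (curl_sup_rate)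
open NE7CovGradBootstrapAlgebra (exists_cube_root caseB_bound rate_caseA rate_caseB rate_normal)

noncomputable section

variable {n : Type*} [Fintype n] [DecidableEq n]

/-! ## §1 The maximum of the covariant gradient over the period torus -/

/-- **THE MAXIMUM OF A PERIODIC BOND QUANTITY**: for `P ≥ 1` and `g : Site 4 → Fin 4 → Fin 4 → ℝ` `P`-periodic in the site, `g` attains a maximum (the period box is finite).
[folklore] -/
theorem exists_max_periodic₃ {P : ℕ} [NeZero P] (g : Site 4 → Fin 4 → Fin 4 → ℝ)
    (hg : ∀ (y : Site 4) (i κ τ : Fin 4), g (y + (P : ℤ) • e i) κ τ = g y κ τ) :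
    ∃ G : ℝ, (∃ (y : Site 4) (κ τ : Fin 4), G = g y κ τ) ∧ ∀ (y : Site 4) (κ τ : Fin 4), g y κ τ ≤ G := by
  classical
  have hP : 1 ≤ P := Nat.one_le_iff_ne_zero.mpr (NeZero.ne P)
  have h0 : (0 : Site 4) ∈ periodBox (d := 4) P :=
    mem_periodBox.mpr fun _ => ⟨le_rfl, by simp only [Pi.zero_apply]; exact_mod_cast (by omega : 0 < P)⟩
  have hSne : ((periodBox (d := 4) P) ×ˢ ((univ : Finset (Fin 4)) ×ˢ (univ : Finset (Fin 4)))).Nonempty :=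
    ⟨((0 : Site 4), (0 : Fin 4), (0 : Fin 4)), Finset.mem_product.mpr ⟨h0, Finset.mem_product.mpr ⟨mem_univ _, mem_univ _⟩⟩⟩
  obtain ⟨t₀, -, ht₀⟩ := Finset.exists_mem_eq_sup' hSne (fun t => g t.1 t.2.1 t.2.2)
  refine ⟨((periodBox (d := 4) P) ×ˢ ((univ : Finset (Fin 4)) ×ˢ (univ : Finset (Fin 4)))).sup' hSne (fun t => g t.1 t.2.1 t.2.2),
    ⟨t₀.1, t₀.2.1, t₀.2.2, ht₀⟩, fun y κ τ => ?_⟩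
  -- reduce `y` into the period box by periodicity
  have hval : g y κ τ = g (boxVec P (redN P y)) κ τ := by
    have h := periodic_smul_vec (f := fun x => g x κ τ) (fun x i => hg x i κ τ) (boxVec P (redN P y)) (fun i => y i / (P : ℤ))
    rw [← eq_wrap_add P y] at h
    exact h
  have hmem : (boxVec P (redN P y), κ, τ) ∈ (periodBox (d := 4) P) ×ˢ ((univ : Finset (Fin 4)) ×ˢ (univ : Finset (Fin 4))) :=
    Finset.mem_product.mpr ⟨boxVec_redN_mem P y, Finset.mem_product.mpr ⟨mem_univ _, mem_univ _⟩⟩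
  rw [hval]
  exact Finset.le_sup' (fun t : Site 4 × Fin 4 × Fin 4 => g t.1 t.2.1 t.2.2) hmem

/-- **THE MAXIMUM OF THE COVARIANT GRADIENT**: for `W` and `X` `P`-periodic, the bond quantity `‖Ad_{W(y+e_κ,τ)}X(y+e_τ,κ) − X(y,κ)‖` attains a maximum `G` over all bonds.
[folklore] -/
theorem exists_max_covGrad {P : ℕ} [NeZero P] {W : Site 4 → Fin 4 → (Matrix n n ℂ)ˣ} (hWP : IsPeriodicCfg W (P : ℤ))
    {X : Site 4 → Fin 4 → Matrix n n ℂ} (hXP : IsPeriodicDir X (P : ℤ)) :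
    ∃ G : ℝ, (∃ (y : Site 4) (κ τ : Fin 4), G = ‖Ad (W (y + e κ) τ) (X (y + e τ) κ) - X y κ‖) ∧
      ∀ (y : Site 4) (κ τ : Fin 4), ‖Ad (W (y + e κ) τ) (X (y + e τ) κ) - X y κ‖ ≤ G := by
  refine exists_max_periodic₃ (P := P) (fun y κ τ => ‖Ad (W (y + e κ) τ) (X (y + e τ) κ) - X y κ‖) ?_
  intro y i κ τ
  rw [add_right_comm y ((P : ℤ) • e i) (e κ), add_right_comm y ((P : ℤ) • e i) (e τ), hWP (y + e κ) i τ, hXP (y + e τ) i κ, hXP y i κ]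

/-! ## §2 The covariant-gradient rate of a decomposed pair coordinate -/

set_option maxHeartbeats 800000 in
/-- **THE COVARIANT-GRADIENT RATE (Gᶜ_w) OF A DECOMPOSED PAIR COORDINATE AT ONE LEVEL** (statement and argument in the file header; `θ^{18} = 2⁻¹`, level `j+1`). [folklore] -/
theorem covGrad_rate [Nonempty n] :
    ∃ KG : ℝ, 0 < KG ∧ ∃ ε₀ : ℝ, 0 < ε₀ ∧ ∀ (N : ℕ) [NeZero N] (j : ℕ) (ε CSε c cN : ℝ), 0 < ε → ε ≤ ε₀ → 0 ≤ CSε → CSε ≤ 1 / 48 → 0 ≤ c → 0 ≤ cN →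
      ∀ (W : Site 4 → Fin 4 → (Matrix n n ℂ)ˣ), IsUnitaryCfg W → IsPeriodicCfg W ((N * 2 ^ (j + 1) : ℕ) : ℤ) →
      SmallField W (ε / (((2 : ℕ) : ℝ) ^ (j + 1)) ^ 2) → LevelSmall 4 2 j (ε / (((2 : ℕ) : ℝ) ^ (j + 1)) ^ 2) →
      ∀ (X XT XN : Site 4 → Fin 4 → Matrix n n ℂ), IsSkewDir X → IsPeriodicDir X ((N * 2 ^ (j + 1) : ℕ) : ℤ) → X = XT + XN →
      XT ∈ energyBlockLandauW (d := 4) (n := n) 2 N (j + 1) W →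
      ∀ (α : ℝ), (∀ x μ, ‖X x μ‖ ≤ α) → α * ((2 : ℕ) : ℝ) ^ (j + 1) ≤ CSε → SmallField (vary W X 1) (ε / (((2 : ℕ) : ℝ) ^ (j + 1)) ^ 2) →
      ∀ (γ : ℝ), 0 < γ → ((2 : ℕ) : ℝ) ^ (j + 1) * energyNormW 2 (j + 1) W X (periodBox (d := 4) (N * 2 ^ (j + 1))) ≤ γ ^ 3 →
      (∀ (y : Site 4) (μ : Fin 4), ‖XN y μ‖ ≤ cN / ((2 : ℕ) : ℝ) ^ (j + 1) * energyNormW 2 (j + 1) W X (periodBox (d := 4) (N * 2 ^ (j + 1))) ^ 2) →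
      (∀ (z : Site 4) (μ ν : Fin 4), μ ≠ ν →
        ‖curlAt W XN z μ ν‖ ≤ cN / (((2 : ℕ) : ℝ) ^ (j + 1)) ^ 2 * energyNormW 2 (j + 1) W X (periodBox (d := 4) (N * 2 ^ (j + 1))) ^ 2) →
      (∀ (p : Site 4) (lam μ ν : Fin 4), μ ≠ ν →
        ‖Ad (W p lam) ((hol W (p + e lam) (plaqWord μ ν) : (Matrix n n ℂ)ˣ) : Matrix n n ℂ) - ((hol W p (plaqWord μ ν) : (Matrix n n ℂ)ˣ) : Matrix n n ℂ)‖
          ≤ 2 * (c + curConst 4 2 * ε ^ 2) / (((2 : ℕ) : ℝ) ^ (j + 1)) ^ 3) →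
      (∀ (p : Site 4) (lam μ ν : Fin 4), μ ≠ ν →
        ‖Ad (vary W X 1 p lam) ((hol (vary W X 1) (p + e lam) (plaqWord μ ν) : (Matrix n n ℂ)ˣ) : Matrix n n ℂ)
            - ((hol (vary W X 1) p (plaqWord μ ν) : (Matrix n n ℂ)ˣ) : Matrix n n ℂ)‖ ≤ 2 * c / (((2 : ℕ) : ℝ) ^ (j + 1)) ^ 3) →
      ∀ (θ : ℝ), 0 < θ → θ ^ 18 = (((2 : ℕ) : ℝ))⁻¹ →
      ∀ (κ : Fin 4) (x : Site 4) (μ : Fin 4),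
        ‖Ad (W (x + e κ) μ) (X (x + e μ) κ) - X x κ‖
          ≤ (32 * KG * (max γ (max 1 (10 * c + 6 * curConst 4 2 * ε ^ 2 + 8 * CSε * ε + 4096 * CSε ^ 2 * ε + 1330 * CSε ^ 3))) ^ 2 * γ * (1 - θ)⁻¹
              + 2 ^ 27 * CSε ^ 2 * KG ^ 3 * γ ^ 3 * ((1 - θ)⁻¹) ^ 3
              + 2 * (KG * cN * γ ^ 6 * (1 - θ)⁻¹ + 2 * cN * γ ^ 6)) * θ ^ (38 * (j + 1)) := by
  obtain ⟨KG, hKG, ε₀, hε₀, hcurved⟩ := curved_grad_letter (d := 3) (n := n) (by norm_num) (le_refl 2)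
  refine ⟨KG, hKG, ε₀, hε₀, ?_⟩
  intro N _ j ε CSε c cN hε hεε₀ hC0 hC hc hcN W hWu hWP hWx hs X XT XN hXs hXP hXdec hXT α hXα hαM hUx γ hγ hEγ hNs hNc hx₁W hx₁U θ hθ hθ18 κ x μ
  have hN : 1 ≤ N := Nat.one_le_iff_ne_zero.mpr (NeZero.ne N)
  haveI : NeZero (N * 2 ^ (j + 1)) := ⟨Nat.mul_ne_zero (NeZero.ne N) (pow_ne_zero _ (by norm_num))⟩
  -- (0) scales and sizes
  set M : ℝ := ((2 : ℕ) : ℝ) ^ (j + 1) with hM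
  have hM1 : 1 ≤ M := one_le_pow₀ (by norm_num)
  have hM0 : 0 < M := by positivity
  have hθ1 : θ < 1 := theta18_lt_one (le_refl 2) hθ18
  have hθ0 : 0 ≤ θ := hθ.le
  have hξ : θ ^ (18 * (j + 1)) = M⁻¹ := by rw [pow_mul, hθ18, hM, inv_pow]
  set E : ℝ := energyNormW 2 (j + 1) W X (periodBox (d := 4) (N * 2 ^ (j + 1))) with hEdef
  have hE0 : 0 ≤ E := energyNormW_nonneg _ _ _ _ _
  have hE : E ≤ γ ^ 3 * θ ^ (18 * (j + 1)) := by
    rw [hξ, ← div_eq_mul_inv, le_div_iff₀ hM0, mul_comm]; exact hEγ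
  have hE2 : E ^ 2 ≤ γ ^ 6 * θ ^ (36 * (j + 1)) := by
    have h := pow_le_pow_left₀ hE0 hE 2
    have e : (γ ^ 3 * θ ^ (18 * (j + 1))) ^ 2 = γ ^ 6 * θ ^ (36 * (j + 1)) := by
      rw [mul_pow, ← pow_mul, ← pow_mul]; ring_nf
    rwa [e] at h
  have hγ6 : 0 ≤ γ ^ 6 := by positivity
  -- the normal part's letters in the `θ` currency
  have hM1inv : M⁻¹ = θ ^ (18 * (j + 1)) := hξ.symm
  have hNM1 : cN / M * E ^ 2 ≤ cN * γ ^ 6 * θ ^ (54 * (j + 1)) := by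
    rw [div_eq_mul_inv, hM1inv]
    have e : cN * γ ^ 6 * θ ^ (54 * (j + 1)) = cN * θ ^ (18 * (j + 1)) * (γ ^ 6 * θ ^ (36 * (j + 1))) := by
      rw [show 54 * (j + 1) = 18 * (j + 1) + 36 * (j + 1) by ring, pow_add]; ring
    rw [e]; exact mul_le_mul_of_nonneg_left hE2 (by positivity)
  have hNM2 : cN / M ^ 2 * E ^ 2 ≤ cN * γ ^ 6 * θ ^ (72 * (j + 1)) := by
    rw [div_eq_mul_inv, ← inv_pow, hM1inv, ← pow_mul]
    have e : cN * γ ^ 6 * θ ^ (72 * (j + 1)) = cN * θ ^ (18 * (j + 1) * 2) * (γ ^ 6 * θ ^ (36 * (j + 1))) := by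
      rw [show 72 * (j + 1) = 18 * (j + 1) * 2 + 36 * (j + 1) by ring, pow_add]; ring
    rw [e]; exact mul_le_mul_of_nonneg_left hE2 (by positivity)
  -- the logarithm: `1 + log M ≤ 1 + (j+1)`
  have hlogM : Real.log M ≤ ((j + 1 : ℕ) : ℝ) := by
    rw [hM, Real.log_pow]
    have h2 : Real.log ((2 : ℕ) : ℝ) ≤ 1 := by
      have := Real.log_le_sub_one_of_pos (show (0 : ℝ) < ((2 : ℕ) : ℝ) by norm_num); norm_num at this ⊢; linarith
    have hk : (0 : ℝ) ≤ ((j + 1 : ℕ) : ℝ) := by positivity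
    calc ((j + 1 : ℕ) : ℝ) * Real.log ((2 : ℕ) : ℝ) ≤ ((j + 1 : ℕ) : ℝ) * 1 := mul_le_mul_of_nonneg_left h2 hk
      _ = _ := mul_one _
  have hlog0 : 0 ≤ Real.log M := Real.log_nonneg hM1
  have hlog1 : 1 + Real.log M ≤ 1 + ((j + 1 : ℕ) : ℝ) := by linarith
  -- (1) the maximum `G` of the covariant gradient
  obtain ⟨G, ⟨y₀, κ₀, τ₀, hGeq⟩, hle⟩ := exists_max_covGrad (P := N * 2 ^ (j + 1)) hWP hXP
  have hG0 : 0 ≤ G := (norm_nonneg _).trans (hle x κ μ)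
  refine (hle x κ μ).trans ?_
  -- (2) the normal part at the maximising bond
  have hXNpt : ∀ y ν, ‖XN y ν‖ ≤ cN / M * E ^ 2 := hNs
  have hvN : ‖Ad (W (y₀ + e κ₀) τ₀) (XN (y₀ + e τ₀) κ₀) - XN y₀ κ₀‖ ≤ 2 * (cN / M * E ^ 2) := by
    refine (norm_sub_le _ _).trans ?_
    rw [norm_Ad_of_unitary (hWu _ _)]
    linarith [hXNpt (y₀ + e τ₀) κ₀, hXNpt y₀ κ₀]
  -- (3) the split at the maximising bond
  have hsplit : G ≤ ‖Ad (W (y₀ + e κ₀) τ₀) (XT (y₀ + e τ₀) κ₀) - XT y₀ κ₀‖ + 2 * (cN / M * E ^ 2) := by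
    rw [hGeq]
    have eX : ∀ y ν, X y ν = XT y ν + XN y ν := fun y ν => by rw [hXdec]; rfl
    rw [eX, eX, Ad_add]
    calc ‖Ad (W (y₀ + e κ₀) τ₀) (XT (y₀ + e τ₀) κ₀) + Ad (W (y₀ + e κ₀) τ₀) (XN (y₀ + e τ₀) κ₀) - (XT y₀ κ₀ + XN y₀ κ₀)‖
        = ‖(Ad (W (y₀ + e κ₀) τ₀) (XT (y₀ + e τ₀) κ₀) - XT y₀ κ₀) + (Ad (W (y₀ + e κ₀) τ₀) (XN (y₀ + e τ₀) κ₀) - XN y₀ κ₀)‖ := by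
          congr 1; abel
      _ ≤ _ := (norm_add_le _ _).trans (add_le_add le_rfl hvN)
  -- (4) the curl of the slice part from a curl bound of `X`
  have hcurlT : ∀ {BX : ℝ}, (∀ (z : Site 4) (μ' ν' : Fin 4), μ' ≠ ν' → ‖curlAt W X z μ' ν'‖ ≤ BX) →
      ∀ (z : Site 4) (μ' ν' : Fin 4), μ' ≠ ν' → ‖curlAt W XT z μ' ν'‖ ≤ BX + cN / M ^ 2 * E ^ 2 := by
    intro BX hBX z μ' ν' hne
    have e : curlAt W XT z μ' ν' = curlAt W X z μ' ν' - curlAt W XN z μ' ν' := by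
      rw [hXdec, curlAt_add]; abel
    rw [e]
    exact (norm_sub_le _ _).trans (add_le_add (hBX z μ' ν' hne) (hNc z μ' ν' hne))
  -- (5) the curved C¹ letter of the slice part, for a curl bound `BX > 0` of `X`
  have hT : (tower 2 N (j + 1) : ℕ) = N * 2 ^ (j + 1) := by rw [tower_eq_pow_mul, Nat.mul_comm]
  have hWPt : IsPeriodicCfg W ((tower 2 N (j + 1) : ℕ) : ℤ) := by rw [hT]; exact hWP
  have hx0 : 0 ≤ ε / M ^ 2 := by positivity
  have hεM : (((2 : ℕ) : ℝ) ^ (j + 1)) ^ 2 * (ε / M ^ 2) ≤ ε₀ := by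
    rw [← hM, mul_div_cancel₀ _ (by positivity)]; exact hεε₀
  have hstep : ∀ {BX : ℝ}, 0 < BX → (∀ (z : Site 4) (μ' ν' : Fin 4), μ' ≠ ν' → ‖curlAt W X z μ' ν'‖ ≤ BX) →
      G ≤ KG * (1 + ((j + 1 : ℕ) : ℝ)) * BX + (KG * (1 + ((j + 1 : ℕ) : ℝ)) * (cN / M ^ 2 * E ^ 2) + 2 * (cN / M * E ^ 2)) := by
    intro BX hBX hcX
    have hB0 : 0 < BX + cN / M ^ 2 * E ^ 2 := by positivity
    have hcT := hcurlT hcX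
    have h : ‖Ad (W (y₀ + e κ₀) τ₀) (XT (y₀ + e τ₀) κ₀) - XT y₀ κ₀‖ ≤ KG * (1 + Real.log M) * (BX + cN / M ^ 2 * E ^ 2) :=
      hcurved j N W (ε / M ^ 2) hWu hWPt hx0 hs hWx hεM XT hXT (BX + cN / M ^ 2 * E ^ 2) hB0 hcT y₀ τ₀ κ₀
    have hmono : KG * (1 + Real.log M) * (BX + cN / M ^ 2 * E ^ 2) ≤ KG * (1 + ((j + 1 : ℕ) : ℝ)) * (BX + cN / M ^ 2 * E ^ 2) :=
      mul_le_mul_of_nonneg_right (mul_le_mul_of_nonneg_left hlog1 hKG.le) hB0.le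
    have h2 := hsplit.trans (add_le_add (h.trans hmono) le_rfl)
    have e : KG * (1 + ((j + 1 : ℕ) : ℝ)) * (BX + cN / M ^ 2 * E ^ 2) + 2 * (cN / M * E ^ 2)
        = KG * (1 + ((j + 1 : ℕ) : ℝ)) * BX + (KG * (1 + ((j + 1 : ℕ) : ℝ)) * (cN / M ^ 2 * E ^ 2) + 2 * (cN / M * E ^ 2)) := by ring
    rw [← e]; exact h2
  -- (6) the curl bound of `X` for an admissible cube `l₂`
  set Λ0 : ℝ := 10 * c + 6 * curConst 4 2 * ε ^ 2 + 8 * CSε * ε + 4096 * CSε ^ 2 * ε + 1330 * CSε ^ 3 with hΛ0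
  have hΛ00 : 0 ≤ Λ0 := by rw [hΛ0]; have := curConst_nonneg (d := 4) 2; positivity
  have hcurlX : ∀ {l₂ : ℝ}, 0 < l₂ → γ ≤ l₂ → Λ0 + 128 * CSε * M ^ 2 * G ≤ l₂ ^ 3 →
      ∀ (z : Site 4) (μ' ν' : Fin 4), μ' ≠ ν' → ‖curlAt W X z μ' ν'‖ ≤ 8 * l₂ ^ 2 * γ * θ ^ (42 * (j + 1)) := by
    intro l₂ hl₂ hγl hΛ z μ' ν' hne
    exact curl_sup_rate hN j hε hC0 hC hWu hWP hWx hXs hXP hXα hαM hUx hγ hEγ hx₁W hx₁U hle hl₂ hγl (by rw [← hM]; exact hΛ) hθ hθ18 z hne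
  -- (7) THE CASE ANALYSIS on `cG ≤ l₀³`
  set l₀ : ℝ := max γ (max 1 Λ0) with hl₀
  have hl₀γ : γ ≤ l₀ := le_max_left _ _
  have hl₀1 : 1 ≤ l₀ := (le_max_left _ _).trans (le_max_right _ _)
  have hl₀0 : 0 < l₀ := by linarith
  have hl₀Λ : Λ0 ≤ l₀ ^ 3 := by
    have h1 : Λ0 ≤ l₀ := (le_max_right _ _).trans (le_max_right _ _)
    have h2 : l₀ ≤ l₀ ^ 3 := by
      have h3 : 1 ≤ l₀ ^ 2 := one_le_pow₀ hl₀1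
      calc l₀ = l₀ * 1 := (mul_one _).symm
        _ ≤ l₀ * l₀ ^ 2 := mul_le_mul_of_nonneg_left h3 hl₀0.le
        _ = l₀ ^ 3 := by ring
    exact h1.trans h2
  set cc : ℝ := 128 * CSε * M ^ 2 with hcc
  have hcc0 : 0 ≤ cc := by positivity
  set D : ℝ := (1 - θ)⁻¹ with hD
  have hD0 : 0 ≤ D := inv_nonneg.mpr (by linarith)
  set R' : ℝ := KG * (1 + ((j + 1 : ℕ) : ℝ)) * (cN / M ^ 2 * E ^ 2) + 2 * (cN / M * E ^ 2) with hR'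
  have hR'0 : 0 ≤ R' := by positivity
  -- the normal part's rate: `R' ≤ (K_G c_N γ⁶ D + 2 c_N γ⁶) θ^{38k}`
  have hR'le : R' ≤ (KG * cN * γ ^ 6 * D + 2 * cN * γ ^ 6) * θ ^ (38 * (j + 1)) := by
    have h1 : KG * (1 + ((j + 1 : ℕ) : ℝ)) * (cN / M ^ 2 * E ^ 2) ≤ KG * (1 + ((j + 1 : ℕ) : ℝ)) * (cN * γ ^ 6 * θ ^ (72 * (j + 1))) :=
      mul_le_mul_of_nonneg_left hNM2 (by positivity)
    have h2 : 2 * (cN / M * E ^ 2) ≤ 2 * (cN * γ ^ 6 * θ ^ (54 * (j + 1))) := by linarith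
    have h3 := rate_normal (A := KG * cN * γ ^ 6) (B := 2 * cN * γ ^ 6) hθ0 hθ1 (by positivity) (by positivity) (j + 1)
    calc R' ≤ KG * (1 + ((j + 1 : ℕ) : ℝ)) * (cN * γ ^ 6 * θ ^ (72 * (j + 1))) + 2 * (cN * γ ^ 6 * θ ^ (54 * (j + 1))) := add_le_add h1 h2
      _ = KG * cN * γ ^ 6 * (1 + ((j + 1 : ℕ) : ℝ)) * θ ^ (72 * (j + 1)) + 2 * cN * γ ^ 6 * θ ^ (54 * (j + 1)) := by ring
      _ ≤ (KG * cN * γ ^ 6 * (1 - θ)⁻¹ + 2 * cN * γ ^ 6) * θ ^ (38 * (j + 1)) := h3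
  have hθ38 : 0 ≤ θ ^ (38 * (j + 1)) := pow_nonneg hθ0 _
  -- the three constants of the bound are non-negative
  have hA0 : 0 ≤ 32 * KG * l₀ ^ 2 * γ * D := by positivity
  have hB0 : 0 ≤ 2 ^ 27 * CSε ^ 2 * KG ^ 3 * γ ^ 3 * D ^ 3 := by positivity
  have hC0' : 0 ≤ 2 * (KG * cN * γ ^ 6 * D + 2 * cN * γ ^ 6) := by positivity
  rcases le_or_gt (cc * G) (l₀ ^ 3) with hA | hB
  · -- CASE A: `l₂ := 2l₀`
    have hl₂ : 0 < 2 * l₀ := by positivity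
    have hΛ : Λ0 + 128 * CSε * M ^ 2 * G ≤ (2 * l₀) ^ 3 := by
      have : 0 ≤ l₀ ^ 3 := by positivity
      rw [← hcc]; nlinarith
    have hcX := hcurlX hl₂ (by linarith) hΛ
    have hBX : 0 < 8 * (2 * l₀) ^ 2 * γ * θ ^ (42 * (j + 1)) :=
      mul_pos (mul_pos (mul_pos (by norm_num) (pow_pos (by linarith) 2)) hγ) (pow_pos hθ _)
    have h1 := hstep hBX hcX
    have h2 : KG * (1 + ((j + 1 : ℕ) : ℝ)) * (8 * (2 * l₀) ^ 2 * γ * θ ^ (42 * (j + 1)))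
        = (32 * KG * l₀ ^ 2 * γ) * (1 + ((j + 1 : ℕ) : ℝ)) * θ ^ (42 * (j + 1)) := by ring
    have h3 := rate_caseA (A := 32 * KG * l₀ ^ 2 * γ) hθ0 hθ1 (by positivity) (j + 1)
    rw [h2] at h1
    have h4 : G ≤ 32 * KG * l₀ ^ 2 * γ * D * θ ^ (38 * (j + 1)) + (KG * cN * γ ^ 6 * D + 2 * cN * γ ^ 6) * θ ^ (38 * (j + 1)) := by
      linarith
    have p1 : 0 ≤ 2 ^ 27 * CSε ^ 2 * KG ^ 3 * γ ^ 3 * D ^ 3 * θ ^ (38 * (j + 1)) := mul_nonneg hB0 hθ38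
    have p2 : 0 ≤ (KG * cN * γ ^ 6 * D + 2 * cN * γ ^ 6) * θ ^ (38 * (j + 1)) := mul_nonneg (by positivity) hθ38
    have e : (32 * KG * l₀ ^ 2 * γ * D + 2 ^ 27 * CSε ^ 2 * KG ^ 3 * γ ^ 3 * D ^ 3 + 2 * (KG * cN * γ ^ 6 * D + 2 * cN * γ ^ 6)) * θ ^ (38 * (j + 1))
        = 32 * KG * l₀ ^ 2 * γ * D * θ ^ (38 * (j + 1)) + 2 ^ 27 * CSε ^ 2 * KG ^ 3 * γ ^ 3 * D ^ 3 * θ ^ (38 * (j + 1))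
          + 2 * ((KG * cN * γ ^ 6 * D + 2 * cN * γ ^ 6) * θ ^ (38 * (j + 1))) := by ring
    rw [e]; linarith
  · -- CASE B: `l₂³ := 2cG`
    have hccG : 0 < cc * G := lt_of_le_of_lt (by positivity) hB
    have hcc1 : 0 < cc := by
      rcases hcc0.eq_or_lt with h | h
      · rw [← h, zero_mul] at hccG; exact absurd hccG (lt_irrefl 0)
      · exact h
    obtain ⟨l₂, hl₂, hl₂3⟩ := exists_cube_root (show 0 < 2 * cc * G by linarith [hccG])
    have hl₀l₂ : l₀ ≤ l₂ := by
      by_contra hlt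
      have hlt' : l₂ < l₀ := lt_of_not_ge hlt
      have h3 : l₂ ^ 3 < l₀ ^ 3 := pow_lt_pow_left₀ hlt' hl₂.le (by norm_num)
      have h4 : 0 ≤ cc * G := hccG.le
      linarith
    have hΛ : Λ0 + 128 * CSε * M ^ 2 * G ≤ l₂ ^ 3 := by rw [← hcc, hl₂3]; nlinarith
    have hcX := hcurlX hl₂ (hl₀γ.trans hl₀l₂) hΛ
    have hBX : 0 < 8 * l₂ ^ 2 * γ * θ ^ (42 * (j + 1)) := mul_pos (mul_pos (mul_pos (by norm_num) (pow_pos hl₂ 2)) hγ) (pow_pos hθ _)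
    have h1 := hstep hBX hcX
    -- `G ≤ K′ l₂² + R′`
    set K' : ℝ := KG * (1 + ((j + 1 : ℕ) : ℝ)) * (8 * γ * θ ^ (42 * (j + 1))) with hK'
    have hK'0 : 0 ≤ K' := by positivity
    have h1' : G ≤ K' * l₂ ^ 2 + R' := by
      have e : KG * (1 + ((j + 1 : ℕ) : ℝ)) * (8 * l₂ ^ 2 * γ * θ ^ (42 * (j + 1))) = K' * l₂ ^ 2 := by rw [hK']; ring
      linarith
    have h2 := caseB_bound hcc1 hK'0 hR'0 hl₂ (by rw [hl₂3]) h1'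
    -- `16 cc² K′³ = 2²⁷ C_Sε² K_G³ γ³ (1+k)³ θ^{54k}` (using `M⁴ θ^{72k} = 1`)
    have hM4 : M ^ 4 * θ ^ (72 * (j + 1)) = 1 := by
      rw [show 72 * (j + 1) = 18 * (j + 1) * 4 by ring, pow_mul, hξ, ← mul_pow, mul_inv_cancel₀ hM0.ne', one_pow]
    have h3 : 16 * cc ^ 2 * K' ^ 3 = 2 ^ 27 * CSε ^ 2 * KG ^ 3 * γ ^ 3 * (1 + ((j + 1 : ℕ) : ℝ)) ^ 3 * θ ^ (54 * (j + 1)) := by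
      have e : (θ ^ (42 * (j + 1))) ^ 3 = θ ^ (72 * (j + 1)) * θ ^ (54 * (j + 1)) := by
        rw [← pow_mul, ← pow_add]; congr 1; ring
      rw [hcc, hK']
      calc 16 * (128 * CSε * M ^ 2) ^ 2 * (KG * (1 + ((j + 1 : ℕ) : ℝ)) * (8 * γ * θ ^ (42 * (j + 1)))) ^ 3
          = 2 ^ 27 * CSε ^ 2 * KG ^ 3 * γ ^ 3 * (1 + ((j + 1 : ℕ) : ℝ)) ^ 3 * (M ^ 4 * (θ ^ (42 * (j + 1))) ^ 3) := by ring
        _ = 2 ^ 27 * CSε ^ 2 * KG ^ 3 * γ ^ 3 * (1 + ((j + 1 : ℕ) : ℝ)) ^ 3 * θ ^ (54 * (j + 1)) := by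
          rw [e, ← mul_assoc (M ^ 4), hM4, one_mul]
    have h4 := rate_caseB (A := 2 ^ 27 * CSε ^ 2 * KG ^ 3 * γ ^ 3) hθ0 hθ1 (by positivity) (j + 1)
    rw [h3] at h2
    have h5 : G ≤ 2 ^ 27 * CSε ^ 2 * KG ^ 3 * γ ^ 3 * D ^ 3 * θ ^ (38 * (j + 1))
        + 2 * ((KG * cN * γ ^ 6 * D + 2 * cN * γ ^ 6) * θ ^ (38 * (j + 1))) := by
      linarith
    have p1 : 0 ≤ 32 * KG * l₀ ^ 2 * γ * D * θ ^ (38 * (j + 1)) := mul_nonneg hA0 hθ38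
    have e : (32 * KG * l₀ ^ 2 * γ * D + 2 ^ 27 * CSε ^ 2 * KG ^ 3 * γ ^ 3 * D ^ 3 + 2 * (KG * cN * γ ^ 6 * D + 2 * cN * γ ^ 6)) * θ ^ (38 * (j + 1))
        = 32 * KG * l₀ ^ 2 * γ * D * θ ^ (38 * (j + 1)) + 2 ^ 27 * CSε ^ 2 * KG ^ 3 * γ ^ 3 * D ^ 3 * θ ^ (38 * (j + 1))
          + 2 * ((KG * cN * γ ^ 6 * D + 2 * cN * γ ^ 6) * θ ^ (38 * (j + 1))) := by ring
    rw [e]; linarith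

end

end Summit.QuantumFields.BalabanUV.T4Continuum.NE7PairCovGradRate
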